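import Summits.BirchSwinnertonDyer.BirchSwinnertonDyer.Theorems.PrintCFramBottomClassIndexLawFiveLeSelmerDevissageCount
import Summits.BirchSwinnertonDyer.BirchSwinnertonDyer.Theorems.PrintCFramBottomClassIndexLawFiveLeLevelDictionaryKummer
import Summits.BirchSwinnertonDyer.Rank1Residual.X2.ResidualDevissageModules
import Literature.NumberTheory.EllipticCurves.SelmerLocalRestrictionKernel
import Literature.NumberTheory.EllipticCurves.SelmerFiniteProofs
import Literature.NumberTheory.EllipticCurves.LocalTorsionCohomologyCoprime
import Literature.NumberTheory.EllipticCurves.CasselsTateSelmerKolyvaginValue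
import Literature.NumberTheory.EllipticCurves.GaloisActionProofs
import HarnessLib

/-!
# Route `PrintCFram`, crux C2 `BottomClassIndexLawFiveLe` (stmt-BirchSwinnertonDyer-20372), line
# `eisenstein-resource-bdp-line` (registry v19, stub B1 `stub_bsdp_of_classFactor`): **THE SELMER COUNT BY DÉVISSAGE
# OVER `ℚ`** — `#Sel_p(W/ℚ) ≤ p · #R_str(W[p]/Φ) · #R_str(Φ)` for a `Γ_ℚ`-stable line `Φ ≤ W[p]`
# (cell `bsd-print-cfram`, width seat `bsd-line-cfram-p1-w2` g9; helper `--supports` 20372; 0 defs, 0 facts, 0 sorry)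

HONEST FRAMING. Nothing about BSD is proved here and no stub is closed. This is the READING of the abstract dévissage
count (`…SelmerDevissageCount`, p673493) on the `p`-Selmer group of an elliptic curve over `ℚ`, the UPPER half of
the parity split of B1 (w2 g8 `…ParitySplit`, LEAD g11 22:11:05Z: «on B1 ∩ {#Sel_p ≤ p²}, BSD_p ⟺ p ∤ #Ш_an(W)»).
For a class member (`HasCM`, `CMRamified W p`, `p ≥ 5`) and its rational line `Φ = W[𝔭]` every hypothesis below is
a landed class-side input (`W(ℚ_p)[p] = 0`: `prime_nsmul_eq_zero_padic_of_hasCM_of_cmRamified`; at the bad `ℓ ≠ p`: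
`W(ℚ_ℓ)[p] = 0` and `(W[p]/Φ)^{I_ℓ} = 0`, w6 g3 `…LevelDictionaryLocalInputs`; `(W[p]/Φ)^{D_p} = 0`: the quotient
character is ramified at `p`), and the two factors on the right are what the CLASS-GROUP side (w7 g3: odd count by
Mazur–Wiles, even count by the Kummer reflection `…HerbrandKummerReflectionCount`) bounds by `p^{u(θ)}`.

Notation: `Γ = Γ_ℚ`, `M = W[p] = geomTorsion W p`, `Φ : StableSubgroup Γ M` (w4/w5's `X2.ResidualDevissageModules`:
sub `Φ.Sub`, quotient `Φ.Quot`), `v` THE place of `ℚ` above `p`, `D_p = GreenbergSelmer.decomp v`, `I_𝔓 = 𝔓.inertia Γ`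
for a prime `𝔓` of `\bar ℤ`, `S_p = {v' | p ∈ v'}`; for a discrete `Γ`-module `A`:
`R_rel(A) := h1Unramified A S_p` (classes that are coboundaries on every `I_𝔓`, `𝔓 ∤ p` — RELAXED at `p`) and
`R_str(A) := R_rel(A) ⊓ subgroupResKer A D_p` (moreover a coboundary on `D_p` — STRICT at `p`).

* §1 (any number field `K`) the local conditions of a Selmer class as coboundary conditions:
  `mem_subgroupResKer_inertia_of_mem_selmerGroup` — at a place `v' ∤ p` which is GOOD (Silverman X.4.4, tree
  `selmerGroup_le_h1Unramified_holds`) or where `W(K_{v'})[p] = 0` (locally trivial, tree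
  `mem_torsionLocalKer_adicCompletion_of_forall_nsmul_eq_zero` + w4's `coboundaryOn_inertia_of_mem_torsionLocalKer`), a
  Selmer class is a coboundary on `I_𝔓` for every `𝔓 ∣ v'`; `mem_subgroupResKer_decomp_of_mem_selmerResKer` — a class of
  `Z_v = selmerResKer` is a coboundary on `D_v`; `natCard_selmerResKer_le` — `#Z_v ≤ #(Sel ⊓ ker res_{D_v})`.
* §2 `iInf_subgroupResKer_le_h1Unramified_inf` — the family `𝓘 = {I_𝔓 : 𝔓 ∤ p} ∪ {D_p}` cuts out a subgroup of
  `R_str(A)`; `finite_h1Unramified_of_continuous` — `R_rel(A)` is finite (Silverman X.4.3, tree `finite_h1Unramified_holds`).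
* §3 **`natCard_selmerGroup_le_prime_mul_natCard_strict`** — `W/ℚ` elliptic, `p` prime, `Φ ≤ W[p]` a stable line;
  ASSUME `W(ℚ_p)[p] = 0`, `Φ.Quot^{D_p} = 0`, and at every BAD `v' ∤ p`: `W(ℚ_{v'})[p] = 0` and `Φ.Quot^{I_𝔓} = 0`
  (`𝔓 ∣ v'`). THEN **`#Sel_p(W/ℚ) ≤ p · #R_str(Φ.Quot) · #R_str(Φ.Sub)`**: `#Sel_p ≤ p · #Z_p` (tree, Bhargava–Skinner's
  count `natCard_selmerGroup_le_prime_mul_of_natCard_torsion_eq_one`), `Z_p ⊆ Sel_p ∩ ker res_{D_p}`, and the dévissage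
  count for `C = Sel_p ∩ ker res_{D_p}` with the family `𝓘` (`I_𝔓` trivial on `W[p]` at good `𝔓 ∤ p`,
  `Φ.Quot^{I_𝔓} = 0` at bad `𝔓 ∤ p`, `Φ.Quot^{D_p} = 0`). In dimensions: `dim Sel_p(W/ℚ) ≤ 1 + u_str(θ_Q) + u_str(θ_S)`,
  so `u(ψ) ≤ 1 ∧ u(θ_e) = 0 ⟹ #Sel_p ≤ p²` for BOTH models of the CM-ramified pair — the input of
  `ParitySplit.bsdp_of_natCard_selmerGroup_le_sq`. (The sharper ALIGNED / TRANSVERSE counts, with ONE side relaxed at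
  `p`, are the sequel `…SelmerDevissageCountRationalAligned`.)

THEOREMS ONLY; no definition, no named fact, no `sorry`. BSD is not proved by any of this; no summit statement is
proved by this seat. References: [SilvermanAEC2009] X.§4 (Thm. 4.2, Lemma 4.3, Cor. 4.4, Ex. 4.8); [MilneADT2006]
I Lemma 3.3, I.3.8; [BhargavaSkinner2014] proof of Lemma 16; [GreenbergLNM1716] §3; [SerreGaloisCohomology1997]
I.§5.1, II.§1.1; the LEAD g10 report §2 and seat notes w2g8 §4.
-/

set_option autoImplicit false
-- `…BirchSwinnertonDyer.BirchSwinnertonDyer.Theorems…` is the problem's mandated namespace (D-0017).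
set_option linter.dupNamespace false

noncomputable section

open scoped Classical

namespace Summit.BirchSwinnertonDyer.BirchSwinnertonDyer.Theorems.PrintCFram.SelmerCount

open NumberField IsDedekindDomain Field WeierstrassCurve
open Literature.NumberTheory.EllipticCurves Literature.NumberTheory.GaloisRepresentations
  Literature.NumberTheory.EllipticCurves.GreenbergSelmer
open Summit.BirchSwinnertonDyer.BirchSwinnertonDyer.Theorems.PrintCFram.LevelDictionary
open Summit.BirchSwinnertonDyer.Rank1Residual.X2.ResidualDevissageModules

universe u

/-! ## §1 The local conditions of a Selmer class as coboundary conditions -/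

section Local

variable {K : Type u} [Field K] [NumberField K] (W : WeierstrassCurve K) [W.IsElliptic]

/-- **A `p`-Selmer class is a coboundary on every inertia group `I_𝔓`, `𝔓 ∣ v'`, at a place `v' ∤ p` which is
either GOOD or has `W(K_{v'})[p] = 0`.** Good case: Silverman X.4.4 (`selmerGroup_le_h1Unramified_holds` with
`S = {bad} ∪ {v ∣ p}`); torsion-free case: the class is locally trivial at `v'`
(`mem_torsionLocalKer_adicCompletion_of_forall_nsmul_eq_zero`), hence a coboundary on every `I_𝔓` above `v'`
(`coboundaryOn_inertia_of_mem_torsionLocalKer`). [cite: SilvermanAEC2009, Cor. X.4.4] [cite: MilneADT2006, Ch. I, Cor. 2.3] -/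
theorem mem_subgroupResKer_inertia_of_mem_selmerGroup {p : ℕ} [hp : Fact p.Prime]
    {c : galH1Torsion W (p : ℤ)} (hc : c ∈ selmerGroup W (p : ℤ))
    {v' : HeightOneSpectrum (𝓞 K)} (hpv' : ((p : ℕ) : 𝓞 K) ∉ v'.asIdeal)
    (hv' : W.HasGoodReductionAt v' ∨
      ∀ P : (W.baseChange (v'.adicCompletion K)).toAffine.Point, p • P = 0 → P = 0)
    {𝔓 : Ideal (absIntegers (𝓞 K) K)} (h𝔓 : 𝔓 ∈ v'.primesAbove) :
    c ∈ subgroupResKer (geomTorsion W (p : ℤ)) (𝔓.inertia (absoluteGaloisGroup K)) := by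
  have hp0 : ((p : ℕ) : ℤ) ≠ 0 := by exact_mod_cast hp.out.ne_zero
  rcases hv' with hgood | htors
  · -- Silverman X.4.4 with `S = {bad places} ∪ {v ∣ p}`
    have hle := W.selmerGroup_le_h1Unramified_holds hp0
      (S := W.badPlaces (𝓞 K) ∪ {v | (((p : ℕ) : ℤ) : 𝓞 K) ∈ v.asIdeal}) Set.subset_union_left
      (fun v hv ↦ Set.mem_union_right _ hv)
    have hmem := mem_h1Unramified_iff.1 (hle hc) v' (by
      rintro (hbad | hdiv)
      · exact hbad hgood
      · exact hpv' (by simpa using hdiv)) 𝔓 h𝔓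
    exact hmem
  · -- locally trivial at `v'`
    haveI : NeZero p := ⟨hp.out.ne_zero⟩
    have hloc := W.mem_torsionLocalKer_adicCompletion_of_forall_nsmul_eq_zero (v := v') p hpv' htors c
    obtain ⟨z, rfl⟩ := oneCocycleClass_surjective _ c
    obtain ⟨t, ht⟩ := coboundaryOn_inertia_of_mem_torsionLocalKer W hp.out.ne_zero v' z hloc h𝔓
    exact (oneCocycleClass_mem_subgroupResKer_iff _ z).2 ⟨t, fun τ ↦ ht τ τ.2⟩

/-- **A class of `Z_v = selmerResKer` (Selmer, restricting to zero at `K_v`) is a coboundary on the decomposition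
group `D_v`** (`mem_torsionLocalKer_iff_res_eq_zero` + w4's `coboundaryOn_decomp_of_mem_torsionLocalKer`).
[cite: SerreGaloisCohomology1997, I.§5.1 and II.§1.1] -/
theorem mem_subgroupResKer_decomp_of_mem_selmerResKer {p : ℕ} [hp : Fact p.Prime]
    (v : HeightOneSpectrum (𝓞 K)) (c : selmerGroup W (p : ℤ))
    (hc : c ∈ W.selmerResKer (p : ℤ) (v.adicCompletion K)) :
    (c : galH1Torsion W (p : ℤ)) ∈ subgroupResKer (geomTorsion W (p : ℤ)) (decomp v) := by
  haveI : CharZero (v.adicCompletion K) :=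
    charZero_of_injective_algebraMap (algebraMap K (v.adicCompletion K)).injective
  have hres := (W.mem_selmerResKer_iff (p : ℤ) (v.adicCompletion K) c).1 hc
  have hloc : (c : galH1Torsion W (p : ℤ)) ∈ W.torsionLocalKer (v.adicCompletion K) (p : ℤ) :=
    (mem_torsionLocalKer_iff_res_eq_zero (W := W) (E := v.adicCompletion K) hp.out.ne_zero _).2 hres
  obtain ⟨z, hz⟩ := oneCocycleClass_surjective _ (c : galH1Torsion W (p : ℤ))
  rw [← hz] at hloc ⊢
  obtain ⟨t, ht⟩ := coboundaryOn_decomp_of_mem_torsionLocalKer W hp.out.ne_zero v z hloc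
  exact (oneCocycleClass_mem_subgroupResKer_iff _ z).2 ⟨t, fun g ↦ ht g g.2⟩

/-- **`#Z_v ≤ #(Sel_p ∩ ker res_{D_v})`**: `Z_v` embeds into the Selmer classes that are coboundaries on `D_v`.
[cite: BhargavaSkinner2014, proof of Lemma 16] -/
theorem natCard_selmerResKer_le {p : ℕ} [hp : Fact p.Prime] (v : HeightOneSpectrum (𝓞 K)) :
    Nat.card (W.selmerResKer (p : ℤ) (v.adicCompletion K)) ≤
      Nat.card ↥(selmerGroup W (p : ℤ) ⊓ subgroupResKer (geomTorsion W (p : ℤ)) (decomp v)) := by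
  have hp0 : ((p : ℕ) : ℤ) ≠ 0 := by exact_mod_cast hp.out.ne_zero
  haveI : Finite (selmerGroup W (p : ℤ)) := W.finite_selmerGroup_holds hp0
  haveI : Finite ↥(selmerGroup W (p : ℤ) ⊓ subgroupResKer (geomTorsion W (p : ℤ)) (decomp v)) :=
    Finite.of_injective _ (AddSubgroup.inclusion_injective inf_le_left)
  refine Nat.card_le_card_of_injective
    (fun c ↦ (⟨(c.1 : galH1Torsion W (p : ℤ)), AddSubgroup.mem_inf.mpr
      ⟨c.1.2, mem_subgroupResKer_decomp_of_mem_selmerResKer W v c.1 c.2⟩⟩ :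
        ↥(selmerGroup W (p : ℤ) ⊓ subgroupResKer (geomTorsion W (p : ℤ)) (decomp v)))) ?_
  intro x y hxy
  simp only [Subtype.mk.injEq] at hxy
  exact Subtype.ext (Subtype.ext hxy)

end Local

/-! ## §2 The families of subgroups and the target groups `R_rel`, `R_str` -/

section Families

variable {K : Type u} [Field K] [NumberField K]
variable (A : Type u) [AddCommGroup A] [DistribMulAction (absoluteGaloisGroup K) A]
  [TopologicalSpace A] [DiscreteTopology A]

omit [NumberField K] in
/-- **The family `{I_𝔓 : 𝔓 ∤ p} ∪ {D}` cuts out a subgroup of `R_str(A) = h1Unramified A S_p ⊓ ker res_D`.**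
[cite: SilvermanAEC2009, Lemma X.4.3] -/
theorem iInf_subgroupResKer_le_h1Unramified_inf (Sp : Set (HeightOneSpectrum (𝓞 K)))
    (D : Subgroup (absoluteGaloisGroup K)) :
    (⨅ I ∈ ({I | I = D ∨ ∃ (v : HeightOneSpectrum (𝓞 K)) (𝔓 : Ideal (absIntegers (𝓞 K) K)),
        v ∉ Sp ∧ 𝔓 ∈ v.primesAbove ∧ I = 𝔓.inertia (absoluteGaloisGroup K)} :
          Set (Subgroup (absoluteGaloisGroup K))), subgroupResKer A I) ≤
      h1Unramified A Sp ⊓ subgroupResKer A D := by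
  intro c hc
  rw [AddSubgroup.mem_iInf] at hc
  have hc' : ∀ I : Subgroup (absoluteGaloisGroup K), (I = D ∨ ∃ (v : HeightOneSpectrum (𝓞 K))
      (𝔓 : Ideal (absIntegers (𝓞 K) K)), v ∉ Sp ∧ 𝔓 ∈ v.primesAbove ∧
        I = 𝔓.inertia (absoluteGaloisGroup K)) → c ∈ subgroupResKer A I := fun I hI ↦ by
    have h := hc I
    rw [AddSubgroup.mem_iInf] at h
    exact h hI
  refine AddSubgroup.mem_inf.mpr ⟨mem_h1Unramified_iff.2 fun v hv 𝔓 h𝔓 ↦ ?_, hc' D (Or.inl rfl)⟩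
  exact hc' _ (Or.inr ⟨v, 𝔓, hv, h𝔓, rfl⟩)

omit [NumberField K] in
/-- **The family `{I_𝔓 : 𝔓 ∤ p}` cuts out a subgroup of `R_rel(A) = h1Unramified A S_p`.**
[cite: SilvermanAEC2009, Lemma X.4.3] -/
theorem iInf_subgroupResKer_le_h1Unramified (Sp : Set (HeightOneSpectrum (𝓞 K))) :
    (⨅ I ∈ ({I | ∃ (v : HeightOneSpectrum (𝓞 K)) (𝔓 : Ideal (absIntegers (𝓞 K) K)),
        v ∉ Sp ∧ 𝔓 ∈ v.primesAbove ∧ I = 𝔓.inertia (absoluteGaloisGroup K)} :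
          Set (Subgroup (absoluteGaloisGroup K))), subgroupResKer A I) ≤ h1Unramified A Sp := by
  intro c hc
  rw [AddSubgroup.mem_iInf] at hc
  refine mem_h1Unramified_iff.2 fun v hv 𝔓 h𝔓 ↦ ?_
  have h := hc (𝔓.inertia (absoluteGaloisGroup K))
  rw [AddSubgroup.mem_iInf] at h
  exact h ⟨v, 𝔓, hv, h𝔓, rfl⟩

/-- **`R_rel(A)` is finite** for a finite discrete `Γ_K`-module with continuous orbit maps and a finite set of
places (Silverman X.4.3, tree `finite_h1Unramified_holds`; continuity of the action from the continuity of the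
orbit maps, `continuousSMul_iff_stabilizer_isOpen`). [cite: SilvermanAEC2009, Lemma X.4.3] -/
theorem finite_h1Unramified_of_continuous [Finite A]
    (hA : ∀ a : A, Continuous fun g : absoluteGaloisGroup K ↦ g • a)
    {Sp : Set (HeightOneSpectrum (𝓞 K))} (hSp : Sp.Finite) : Finite ↥(h1Unramified A Sp) := by
  haveI : ContinuousSMul (absoluteGaloisGroup K) A := by
    rw [continuousSMul_iff_stabilizer_isOpen]
    intro a
    have h := (isOpen_discrete ({a} : Set A)).preimage (hA a)
    convert h using 1
    ext g
    simp [MulAction.mem_stabilizer_iff]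
  exact finite_h1Unramified_holds K A hSp

end Families

/-! ## §3 The count over `ℚ`: `#Sel_p(W/ℚ) ≤ p · #R_str(W[p]/Φ) · #R_str(Φ)` -/

section Rat

variable (W : WeierstrassCurve ℚ) [W.IsElliptic]

/-- **THE SELMER COUNT BY DÉVISSAGE (both sides strict at `p`).** `W/ℚ` elliptic, `p` a prime, `v` the place of `ℚ`
above `p`, `Φ ≤ W[p]` a `Γ_ℚ`-stable subgroup with sub `Φ.Sub` and quotient `Φ.Quot`. ASSUME: `W(ℚ_p)[p] = 0`;
`Φ.Quot` has no non-zero vector fixed by the decomposition group `D_p = decomp v`; and at every BAD place `v' ∤ p`: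
`W(ℚ_{v'})[p] = 0` and `Φ.Quot` has no non-zero vector fixed by `I_𝔓`, `𝔓 ∣ v'`. THEN, with `S_p = {v' ∣ p}`,
`R_str(A) = h1Unramified A S_p ⊓ ker (H¹(ℚ, A) → H¹(D_p, A))`:
**`#Sel_p(W/ℚ) ≤ p · #R_str(Φ.Quot) · #R_str(Φ.Sub)`.**
PROOF: `#Sel_p ≤ p · #Z_p` (`natCard_selmerGroup_le_prime_mul_of_natCard_torsion_eq_one`, `#W(ℚ_p)/p = p`);
`Z_p ↪ C := Sel_p ∩ ker res_{D_p}` (§1); every class of `C` is a coboundary on `D_p` and on every `I_𝔓`, `𝔓 ∤ p` (§1);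
the dévissage count `SelmerCount.natCard_le_of_devissage_of_coboundaryOn` for the family `{D_p} ∪ {I_𝔓 : 𝔓 ∤ p}`
(`I_𝔓` acts trivially on `W[p]` at good `𝔓 ∤ p`, `smul_geomTorsion_eq_of_mem_inertia`; `Φ.Quot^{I_𝔓} = 0` at bad
`𝔓 ∤ p`; `Φ.Quot^{D_p} = 0`); §2. For a CM-ramified class member and `Φ = W[𝔭]` all four hypotheses are landed class
inputs, and the bound reads `dim Sel_p(W/ℚ) ≤ 1 + u_str(θ_Q) + u_str(θ_S)`.
[cite: SilvermanAEC2009, X.§4 (Cor. 4.4, Ex. 4.8)] [cite: BhargavaSkinner2014, proof of Lemma 16]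
[cite: GreenbergLNM1716, §3 (PDF p. 86)] -/
theorem natCard_selmerGroup_le_prime_mul_natCard_strict {p : ℕ} [hp : Fact p.Prime]
    {v : HeightOneSpectrum (𝓞 ℚ)} (hpv : ((p : ℕ) : 𝓞 ℚ) ∈ v.asIdeal)
    (htors : Nat.card (nsmulAddMonoidHom p :
      (W.baseChange (v.adicCompletion ℚ)).toAffine.Point →+ _).ker = 1)
    (Φ : StableSubgroup (absoluteGaloisGroup ℚ) (geomTorsion W (p : ℤ)))
    (hQD : ∀ q : Φ.Quot, (∀ g ∈ decomp v, g • q = q) → q = 0)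
    (hbad : ∀ v' : HeightOneSpectrum (𝓞 ℚ), ¬ W.HasGoodReductionAt v' → ((p : ℕ) : 𝓞 ℚ) ∉ v'.asIdeal →
      ∀ P : (W.baseChange (v'.adicCompletion ℚ)).toAffine.Point, p • P = 0 → P = 0)
    (hQI : ∀ v' : HeightOneSpectrum (𝓞 ℚ), ¬ W.HasGoodReductionAt v' → ((p : ℕ) : 𝓞 ℚ) ∉ v'.asIdeal →
      ∀ 𝔓 ∈ v'.primesAbove, ∀ q : Φ.Quot,
        (∀ g ∈ 𝔓.inertia (absoluteGaloisGroup ℚ), g • q = q) → q = 0) :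
    Nat.card (selmerGroup W (p : ℤ)) ≤
      p * (Nat.card ↥(h1Unramified Φ.Quot {v' : HeightOneSpectrum (𝓞 ℚ) | ((p : ℕ) : 𝓞 ℚ) ∈ v'.asIdeal} ⊓
              subgroupResKer Φ.Quot (decomp v)) *
            Nat.card ↥(h1Unramified Φ.Sub {v' : HeightOneSpectrum (𝓞 ℚ) | ((p : ℕ) : 𝓞 ℚ) ∈ v'.asIdeal} ⊓
              subgroupResKer Φ.Sub (decomp v))) := by
  have hp0 : ((p : ℕ) : ℤ) ≠ 0 := by exact_mod_cast hp.out.ne_zero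
  set Γ := absoluteGaloisGroup ℚ
  set M := geomTorsion W (p : ℤ) with hM
  set Sp : Set (HeightOneSpectrum (𝓞 ℚ)) := {v' | ((p : ℕ) : 𝓞 ℚ) ∈ v'.asIdeal} with hSp
  -- the family of subgroups
  set 𝓘 : Set (Subgroup Γ) := {I | I = decomp v ∨ ∃ (v' : HeightOneSpectrum (𝓞 ℚ))
      (𝔓 : Ideal (absIntegers (𝓞 ℚ) ℚ)), v' ∉ Sp ∧ 𝔓 ∈ v'.primesAbove ∧ I = 𝔓.inertia Γ} with h𝓘
  -- the subgroup `C = Sel_p ∩ ker res_{D_p}`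
  set C : AddSubgroup (galH1Torsion W (p : ℤ)) := selmerGroup W (p : ℤ) ⊓ subgroupResKer M (decomp v)
    with hC
  -- Step 1: `#Sel_p ≤ p · #Z_p ≤ p · #C`
  have h1 : Nat.card (selmerGroup W (p : ℤ)) ≤ p * Nat.card C :=
    (W.natCard_selmerGroup_le_prime_mul_of_natCard_torsion_eq_one hpv htors).trans
      (Nat.mul_le_mul_left p (natCard_selmerResKer_le W v))
  -- Step 2: the dévissage data
  have hcont : ∀ m : M, Continuous fun g : Γ ↦ g • m := continuous_smul_geomTorsion W (p : ℤ)
  have hι : ∀ (g : Γ) (s : Φ.Sub), Φ.incl (g • s) = g • Φ.incl s := fun _ _ ↦ rfl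
  have hπ : ∀ (g : Γ) (x : M), Φ.proj (g • x) = g • Φ.proj x := fun _ _ ↦ rfl
  have hπι : ∀ s : Φ.Sub, Φ.proj (Φ.incl s) = 0 := fun s ↦ (QuotientAddGroup.eq_zero_iff _).mpr s.2
  have hker : ∀ x : M, Φ.proj x = 0 → ∃ s : Φ.Sub, Φ.incl s = x := fun x hx ↦
    ⟨⟨x, (QuotientAddGroup.eq_zero_iff x).mp hx⟩, rfl⟩
  have hQ𝓘 : ∀ I ∈ 𝓘, (∀ q : Φ.Quot, (∀ g ∈ I, g • q = q) → q = 0) ∨ (∀ g ∈ I, ∀ x : M, g • x = x) := by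
    rintro I (rfl | ⟨v', 𝔓, hv', h𝔓, rfl⟩)
    · exact Or.inl hQD
    · by_cases hgood : W.HasGoodReductionAt v'
      · exact Or.inr fun g hg x ↦ W.smul_geomTorsion_eq_of_mem_inertia hgood
          (n := (p : ℤ)) (by exact_mod_cast hv') h𝔓 hg x
      · exact Or.inl (hQI v' hgood hv' 𝔓 h𝔓)
  have hCloc : ∀ c ∈ C, ∀ I ∈ 𝓘, c ∈ subgroupResKer M I := by
    rintro c hc I (rfl | ⟨v', 𝔓, hv', h𝔓, rfl⟩)
    · exact (AddSubgroup.mem_inf.mp hc).2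
    · have hsel : c ∈ selmerGroup W (p : ℤ) := (AddSubgroup.mem_inf.mp hc).1
      by_cases hgood : W.HasGoodReductionAt v'
      · exact mem_subgroupResKer_inertia_of_mem_selmerGroup W hsel hv' (Or.inl hgood) h𝔓
      · exact mem_subgroupResKer_inertia_of_mem_selmerGroup W hsel hv' (Or.inr (hbad v' hgood hv')) h𝔓
  -- finiteness of the targets
  haveI : Finite M := finite_torsionPoints_holds W (AlgebraicClosure ℚ) hp0
  haveI : Finite Φ.Sub := Finite.of_injective _ Φ.incl_injective
  haveI : Finite Φ.Quot := Finite.of_surjective _ Φ.proj_surjective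
  have hSpfin : Sp.Finite := by
    convert finite_setOf_intCast_mem_asIdeal (K := ℚ) hp0 using 1
    ext v'
    simp only [hSp, Set.mem_setOf_eq, Int.cast_natCast]
  haveI hfQ : Finite ↥(h1Unramified Φ.Quot Sp) :=
    finite_h1Unramified_of_continuous Φ.Quot (Φ.continuous_smul_quot hcont) hSpfin
  haveI hfS : Finite ↥(h1Unramified Φ.Sub Sp) :=
    finite_h1Unramified_of_continuous Φ.Sub (Φ.continuous_smul_sub hcont) hSpfin
  have hleQ := iInf_subgroupResKer_le_h1Unramified_inf Φ.Quot Sp (decomp v)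
  have hleS := iInf_subgroupResKer_le_h1Unramified_inf Φ.Sub Sp (decomp v)
  haveI : Finite ↥(h1Unramified Φ.Quot Sp ⊓ subgroupResKer Φ.Quot (decomp v)) :=
    Finite.of_injective _ (AddSubgroup.inclusion_injective inf_le_left)
  haveI : Finite ↥(h1Unramified Φ.Sub Sp ⊓ subgroupResKer Φ.Sub (decomp v)) :=
    Finite.of_injective _ (AddSubgroup.inclusion_injective inf_le_left)
  have hfinQ : Finite ↥(⨅ I ∈ 𝓘, subgroupResKer Φ.Quot I) :=
    Finite.of_injective _ (AddSubgroup.inclusion_injective hleQ)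
  have hfinS : Finite ↥(⨅ I ∈ 𝓘, subgroupResKer Φ.Sub I) :=
    Finite.of_injective _ (AddSubgroup.inclusion_injective hleS)
  -- Step 3: the dévissage count
  have h2 := natCard_le_of_devissage_of_coboundaryOn hcont Φ.incl Φ.proj hι hπ Φ.incl_injective
    Φ.proj_surjective hπι hker 𝓘 hQ𝓘 C hCloc hfinQ hfinS
  have h3 : Nat.card ↥(⨅ I ∈ 𝓘, subgroupResKer Φ.Quot I) ≤
      Nat.card ↥(h1Unramified Φ.Quot Sp ⊓ subgroupResKer Φ.Quot (decomp v)) :=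
    AddSubgroup.card_le_of_le hleQ
  have h4 : Nat.card ↥(⨅ I ∈ 𝓘, subgroupResKer Φ.Sub I) ≤
      Nat.card ↥(h1Unramified Φ.Sub Sp ⊓ subgroupResKer Φ.Sub (decomp v)) :=
    AddSubgroup.card_le_of_le hleS
  calc Nat.card (selmerGroup W (p : ℤ)) ≤ p * Nat.card C := h1
    _ ≤ p * (Nat.card ↥(⨅ I ∈ 𝓘, subgroupResKer Φ.Quot I) * Nat.card ↥(⨅ I ∈ 𝓘, subgroupResKer Φ.Sub I)) :=
        Nat.mul_le_mul_left p h2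
    _ ≤ _ := Nat.mul_le_mul_left p (Nat.mul_le_mul h3 h4)

/-- **Corollary (the `p²` branch).** Under the hypotheses of `natCard_selmerGroup_le_prime_mul_natCard_strict`, if the
strict residual group of the QUOTIENT is trivial (`#R_str(Φ.Quot) = 1`, i.e. `u(θ_Q) = 0`) and that of the SUB has at
most `p` elements (`u(θ_S) ≤ 1`), then **`#Sel_p(W/ℚ) ≤ p²`** — the hypothesis of w2 g8's
`ParitySplit.bsdp_of_natCard_selmerGroup_le_sq` (with `p ∤ #Ш_an(W)`, Cassels–Tate and GZK it gives `BSD_p`).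
[cite: SilvermanAEC2009, X.§4 (Ex. 4.8)] [cite: GreenbergLNM1716, §3 (PDF p. 86)] -/
theorem natCard_selmerGroup_le_sq_of_strict {p : ℕ} [hp : Fact p.Prime]
    {v : HeightOneSpectrum (𝓞 ℚ)} (hpv : ((p : ℕ) : 𝓞 ℚ) ∈ v.asIdeal)
    (htors : Nat.card (nsmulAddMonoidHom p :
      (W.baseChange (v.adicCompletion ℚ)).toAffine.Point →+ _).ker = 1)
    (Φ : StableSubgroup (absoluteGaloisGroup ℚ) (geomTorsion W (p : ℤ)))
    (hQD : ∀ q : Φ.Quot, (∀ g ∈ decomp v, g • q = q) → q = 0)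
    (hbad : ∀ v' : HeightOneSpectrum (𝓞 ℚ), ¬ W.HasGoodReductionAt v' → ((p : ℕ) : 𝓞 ℚ) ∉ v'.asIdeal →
      ∀ P : (W.baseChange (v'.adicCompletion ℚ)).toAffine.Point, p • P = 0 → P = 0)
    (hQI : ∀ v' : HeightOneSpectrum (𝓞 ℚ), ¬ W.HasGoodReductionAt v' → ((p : ℕ) : 𝓞 ℚ) ∉ v'.asIdeal →
      ∀ 𝔓 ∈ v'.primesAbove, ∀ q : Φ.Quot,
        (∀ g ∈ 𝔓.inertia (absoluteGaloisGroup ℚ), g • q = q) → q = 0)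
    (huQ : Nat.card ↥(h1Unramified Φ.Quot {v' : HeightOneSpectrum (𝓞 ℚ) | ((p : ℕ) : 𝓞 ℚ) ∈ v'.asIdeal} ⊓
      subgroupResKer Φ.Quot (decomp v)) = 1)
    (huS : Nat.card ↥(h1Unramified Φ.Sub {v' : HeightOneSpectrum (𝓞 ℚ) | ((p : ℕ) : 𝓞 ℚ) ∈ v'.asIdeal} ⊓
      subgroupResKer Φ.Sub (decomp v)) ≤ p) :
    Nat.card (selmerGroup W (p : ℤ)) ≤ p ^ 2 := by
  have h := natCard_selmerGroup_le_prime_mul_natCard_strict W hpv htors Φ hQD hbad hQI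
  rw [huQ, one_mul] at h
  calc Nat.card (selmerGroup W (p : ℤ)) ≤ p * _ := h
    _ ≤ p * p := Nat.mul_le_mul_left p huS
    _ = p ^ 2 := (pow_two p).symm

end Rat

end Summit.BirchSwinnertonDyer.BirchSwinnertonDyer.Theorems.PrintCFram.SelmerCount

end
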